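import Literature.Probability.Percolation.FKFreeLoopRepresentation
import Literature.Probability.Percolation.BKWOrientationExpansion
import Literature.Probability.LatticeModels.MedialTrailUmlaufsatz
import HarnessLib

/-!
# The Baxter–Kelland–Wu correspondence on a finite piece of `ℤ²` with free boundary conditions

Third input of the finite-volume Baxter–Kelland–Wu identity behind DKLM 2026, (3.2) / Cor. 10
(`dklm2026_corollary10`): the abstract orientation expansion of `BKWOrientationExpansion`
(`BKW.bkw_configuration_sum`) is specialised to the loops of the free random-cluster model on a
finite piece `Λ ⊆ ℤ²` (`FKFreeLoopRepresentation`: corners `cornerSet Λ`, turning rule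
`pieceCornerPerm Λ ξ`, `loopCount`), and the six-vertex weight it produces is computed.

* `sum_pieceTurn_cls` — **Umlaufsatz for the loops of the piece**: around every cycle of
  `pieceCornerPerm Λ ξ` the quarter turns `turnSign` (`+1` = left = crossing a closed edge,
  `-1` = right = following an open one) sum to `±4` (transfer of
  `MedialTrailUmlaufsatz.inv_cornerOrbit`).
* `bkw_free_piece` — **the BKW identity on the piece**:
  `∑_{ξ ⊆ E_Λ} √q^{ℓ_Λ(ξ)} ∏_{S loop} cos_μ(τ_S θ̃_S) = ∑_{s} W_Λ(s) exp(i ∑_c ε(s c) κ c)` for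
  every corner functional `κ` (`θ̃_S = ∑_{c∈S} κ c`, `τ_S` the sense of rotation), `0 < q ≤ 4`;
  by `rcWeight_rcSelfDualPoint` the left-hand side is, up to the constant
  `(1-p)^{|E_Λ|} √q^{|Λ|} · Z`, the free random-cluster expectation at `p_sd(q)` of the loop
  functional `∏_S cos_μ(τ_S θ̃_S)`.
* `BKW.bkwWeight_powerset_eq_prod` (abstract) and `bkwWeight_free_piece_eq_prod` — **the
  six-vertex weight is a product of local weights over the medial vertices** (target edges):
  `W_Λ(s) = ∏_{e boundary} w⁰_e(s) · ∏_{e ∈ E_Λ} (w⁰_e(s) + w¹_e(s))`, `w⁰/w¹` collecting the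
  compatibility constraint and the turn phases `e^{±iλ/4}` of the corners arriving at `e` when `e`
  is closed/open (`BKW.localW`);
* `localW_closed_add_localW_open` — **the vertex-weight table**: at an interior edge `e` with
  arriving corners `p`, `p̂` and leaving corners `σ⁰p`, `σ⁰p̂`,
  `w⁰_e + w¹_e = sixVertexLocalWeight q (s p) (s p̂) (s σ⁰p) (s σ⁰p̂)`, which is `2cos(λ/2) = c`
  (`c² = 2 + √q`) if the four arrow bits agree (six-vertex types 5, 6), `1` if exactly one of the
  two pairings of in- and out-arrows is consistent (types 1–4), and `0` otherwise (ice rule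
  violated) — Baxter–Kelland–Wu's weights `(1, 1, 1, 1, c, c)`; `localW_boundary` — a boundary
  edge (one endpoint off `Λ`, never open) contributes the phase `e^{iε λ/4}` of its single
  left turn.

Everything is proved; the new definitions are objects (`pieceTurn`, `pieceEdges`, `preimCfg`,
`follow₀`, `follow₁`, `BKW.localW`, `sixVertexLocalWeight`), no named fact is introduced.

## References

* R. J. Baxter, S. B. Kelland, F. Y. Wu, J. Phys. A 9 (1976) 397–406, §3–§4 (polygon
  decomposition, arrow coverings, weights `1,1,1,1, z^{1/2}+z^{-1/2}`). [BaxterKellandWu1976]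
* H. Duminil-Copin, K. K. Kozlowski, P. Lammers, I. Manolescu, arXiv:2603.06268 (2026), §3.2,
  (3.2). [DuminilCopinKozlowskiLammersManolescu2026]
* H. Hopf, Compositio Math. 2 (1935), Satz I (Umlaufsatz). [Hopf1935]
-/

noncomputable section

open Complex Finset Equiv Function
open scoped Real

namespace Literature.Probability.Percolation

open LatticeModels BKW
open Literature.GroupTheory.CombinatorialGroupTheory

/-! ### Abstract: the six-vertex weight factorises over the target edges -/

namespace BKW

variable {C E : Type*} [Fintype C] [DecidableEq E]

/-- The local weight at the target (medial vertex) `e` in the state `b` (successor map `σb`,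
quarter turns `tb` of the corners arriving at `e` when their target edge is in state `b`): the
product over the corners `c` arriving at `e` of the compatibility constraint `s (σb c) = s c`
times the turn phase `exp(i ε(s c) λ tb(c)/4)`. [cite: BaxterKellandWu1976, §4] -/
def localW (tgt : C → E) (σb : C → C) (tb : C → ℤ) (q : ℝ) (s : C → Bool) (e : E) : ℂ :=
  ∏ c ∈ univ.filter (fun c ↦ tgt c = e),
    if s (σb c) = s c then Complex.exp (I * (sgn (s c) : ℂ) * (lam q / 4 * tb c)) else 0

/-- **Factorisation of the six-vertex weight over the target edges.** If the configurations are
all subsets `ξ ⊆ E₀` of a set of edges, and the successor and the quarter turn of each corner `c`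
depend on `ξ` only through the state of its target edge `tgt c` (`σ₁, t₁` if open, `σ₀, t₀` if
closed; every target lies in `M ⊇ E₀`), then
`W(s) = ∏_{e ∈ M ∖ E₀} w⁰_e(s) · ∏_{e ∈ E₀} (w⁰_e(s) + w¹_e(s))`. [cite: BaxterKellandWu1976, §4] -/
theorem bkwWeight_powerset_eq_prod {M E₀ : Finset E} (tgt : C → E) (htgt : ∀ c, tgt c ∈ M)
    (hE₀ : E₀ ⊆ M) (σ : Finset E → Perm C) (σ₀ σ₁ : C → C)
    (hσ : ∀ ξ, ξ ⊆ E₀ → ∀ c, σ ξ c = if tgt c ∈ ξ then σ₁ c else σ₀ c)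
    (t : Finset E → C → ℤ) (t₀ t₁ : C → ℤ)
    (ht : ∀ ξ, ξ ⊆ E₀ → ∀ c, t ξ c = if tgt c ∈ ξ then t₁ c else t₀ c) (q : ℝ) (s : C → Bool) :
    bkwWeight E₀.powerset σ t q s =
      (∏ e ∈ M \ E₀, localW tgt σ₀ t₀ q s e) *
        ∏ e ∈ E₀, (localW tgt σ₀ t₀ q s e + localW tgt σ₁ t₁ q s e) := by
  classical
  -- the summand of `W(s)` is a product over the targets of local terms
  have h1 : ∀ ξ ∈ E₀.powerset,
      (if ∀ c, s (σ ξ c) = s c then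
          ∏ c, Complex.exp (I * (sgn (s c) : ℂ) * (lam q / 4 * t ξ c)) else 0) =
        ∏ e ∈ M, (if e ∈ ξ then localW tgt σ₁ t₁ q s e else localW tgt σ₀ t₀ q s e) := by
    intro ξ hξ
    rw [mem_powerset] at hξ
    rw [← Fintype.prod_ite_zero,
      ← prod_fiberwise_of_maps_to (s := univ) (t := M) (g := tgt) (fun c _ ↦ htgt c)]
    refine prod_congr rfl fun e _ ↦ ?_
    unfold localW
    split_ifs with he
    · refine prod_congr rfl fun c hc ↦ ?_
      rw [mem_filter] at hc
      rw [hσ ξ hξ c, ht ξ hξ c, hc.2, if_pos he, if_pos he]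
    · refine prod_congr rfl fun c hc ↦ ?_
      rw [mem_filter] at hc
      rw [hσ ξ hξ c, ht ξ hξ c, hc.2, if_neg he, if_neg he]
  rw [bkwWeight, sum_filter, sum_congr rfl h1]
  -- split `M = (M ∖ E₀) ∪ E₀`; the first block does not see `ξ`
  have h3 : ∀ ξ ∈ E₀.powerset,
      ∏ e ∈ M, (if e ∈ ξ then localW tgt σ₁ t₁ q s e else localW tgt σ₀ t₀ q s e) =
        (∏ e ∈ M \ E₀, localW tgt σ₀ t₀ q s e) *
          ((∏ e ∈ ξ, localW tgt σ₁ t₁ q s e) * ∏ e ∈ E₀ \ ξ, localW tgt σ₀ t₀ q s e) := by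
    intro ξ hξ
    rw [mem_powerset] at hξ
    rw [← prod_sdiff hE₀]
    congr 1
    · refine prod_congr rfl fun e he ↦ ?_
      rw [mem_sdiff] at he
      rw [if_neg (fun h ↦ he.2 (hξ h))]
    · rw [← prod_sdiff hξ, mul_comm]
      congr 1
      · exact prod_congr rfl fun e he ↦ by rw [if_pos he]
      · refine prod_congr rfl fun e he ↦ ?_
        rw [mem_sdiff] at he
        rw [if_neg he.2]
  rw [sum_congr rfl h3, ← mul_sum]
  congr 1
  rw [prod_congr rfl fun e _ ↦ add_comm (localW tgt σ₀ t₀ q s e) (localW tgt σ₁ t₁ q s e), prod_add]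

end BKW

/-! ### The Umlaufsatz for the loops of the piece -/

section Piece

variable {Λ : Finset (Site 2)}

/-- Powers of the piece permutation are iterates of the turning rule. [cite: Smirnov2001, §2] -/
theorem pieceCornerPerm_pow_apply_val (ξ : Finset (Sym2 ↥Λ)) (c : ↥(cornerSet Λ)) (m : ℕ) :
    ((pieceCornerPerm Λ ξ ^ m) c : Site 2 × Fin 4) = (nextCorner (liftCfg Λ ξ))^[m] c := by
  induction m with
  | zero => rfl
  | succ m ih => rw [pow_succ', Perm.mul_apply, pieceCornerPerm_apply_val, ih, iterate_succ_apply']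

/-- **A cycle of the piece permutation is the set of the first `Q` iterates** (`Q` the minimal
period of the turning rule at the base corner). [cite: Smirnov2001, §2] -/
theorem cls_pieceCornerPerm_eq_image (ξ : Finset (Sym2 ↥Λ)) (c₀ : ↥(cornerSet Λ)) :
    PairingGenus.cls (pieceCornerPerm Λ ξ) c₀ =
      (range (minimalPeriod (nextCorner (liftCfg Λ ξ)) c₀)).image fun m ↦ (pieceCornerPerm Λ ξ ^ m) c₀ := by
  have hp := mem_periodicPts_of_mem_cornerSet ξ c₀.2
  ext c
  rw [PairingGenus.mem_cls, sameCycle_pieceCornerPerm_iff, sameCycle_cornerPerm_iff hp,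
    exists_iterate_lt_iff hp, mem_image]
  constructor
  · rintro ⟨m, hm, h⟩
    exact ⟨m, mem_range.2 hm, Subtype.ext (by rw [pieceCornerPerm_pow_apply_val, h])⟩
  · rintro ⟨m, hm, rfl⟩
    exact ⟨m, mem_range.1 hm, (pieceCornerPerm_pow_apply_val ξ c₀ m).symm⟩

/-- Sums over a cycle of the piece permutation are sums along the orbit of the turning rule.
[cite: Smirnov2001, §2] -/
theorem sum_cls_pieceCornerPerm {M : Type*} [AddCommMonoid M] (ξ : Finset (Sym2 ↥Λ))
    (c₀ : ↥(cornerSet Λ)) (f : Site 2 × Fin 4 → M) :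
    ∑ c ∈ PairingGenus.cls (pieceCornerPerm Λ ξ) c₀, f c =
      ∑ m ∈ range (minimalPeriod (nextCorner (liftCfg Λ ξ)) c₀),
        f ((nextCorner (liftCfg Λ ξ))^[m] c₀) := by
  rw [cls_pieceCornerPerm_eq_image, sum_image]
  · exact sum_congr rfl fun m _ ↦ by rw [pieceCornerPerm_pow_apply_val]
  · intro i hi j hj h
    rw [mem_coe, mem_range] at hi hj
    have h' := congrArg (fun c : ↥(cornerSet Λ) ↦ (c : Site 2 × Fin 4)) h
    simp only [pieceCornerPerm_pow_apply_val] at h'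
    exact (iterate_eq_iterate_iff_of_lt_minimalPeriod hi hj).1 h'

variable (Λ) in
/-- The quarter turn of the loop of the piece at the end of the corner `c`: `-1` (right) if its
target edge is open in `ξ`, `+1` (left) if it is closed (the tree's `turnSign` of the lifted
configuration). [cite: Smirnov2001, §2] -/
def pieceTurn (ξ : Finset (Sym2 ↥Λ)) (c : ↥(cornerSet Λ)) : ℤ := turnSign (liftCfg Λ ξ) c

/-- **Umlaufsatz for the loops of the piece**: around every cycle of the piece permutation the
quarter turns sum to `4` (a counterclockwise loop) or `-4` (a clockwise one).
[cite: Hopf1935, Satz I] -/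
theorem sum_pieceTurn_cls (ξ : Finset (Sym2 ↥Λ)) (c₀ : ↥(cornerSet Λ)) :
    ∑ c ∈ PairingGenus.cls (pieceCornerPerm Λ ξ) c₀, pieceTurn Λ ξ c = 4 ∨
      ∑ c ∈ PairingGenus.cls (pieceCornerPerm Λ ξ) c₀, pieceTurn Λ ξ c = -4 := by
  set β := liftCfg Λ ξ with hβ
  have hp := mem_periodicPts_of_mem_cornerSet ξ c₀.2
  have hQ := minimalPeriod_pos_of_mem_periodicPts hp
  have hsum : ∑ c ∈ PairingGenus.cls (pieceCornerPerm Λ ξ) c₀, pieceTurn Λ ξ c =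
      ∑ m ∈ range (minimalPeriod (nextCorner β) c₀), turnSign β (cornerOrbit β c₀ m) := by
    unfold pieceTurn
    rw [sum_cls_pieceCornerPerm ξ c₀ (turnSign β)]
    exact sum_congr rfl fun m _ ↦ by rw [cornerOrbit_eq_iterate]
  rw [hsum]
  have hper : cornerOrbit β c₀ (minimalPeriod (nextCorner β) c₀) = c₀ := by
    rw [cornerOrbit_eq_iterate]; exact iterate_minimalPeriod
  have hmin : ∀ s, 0 < s → s < minimalPeriod (nextCorner β) c₀ → cornerOrbit β c₀ s ≠ c₀ := by
    intro s hs0 hs h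
    rw [cornerOrbit_eq_iterate] at h
    have := (iterate_eq_iterate_iff_of_lt_minimalPeriod hs hQ).1 (h.trans (iterate_zero_apply _ _).symm)
    omega
  rcases inv_cornerOrbit hQ hper hmin with ⟨h, -⟩ | ⟨h, -⟩
  · exact Or.inl h
  · exact Or.inr h

/-- The Umlaufsatz in the form consumed by `BKW.bkw_configuration_sum`. [cite: Hopf1935, Satz I] -/
theorem sum_pieceTurn_of_mem_cycles (ξ : Finset (Sym2 ↥Λ)) {S : Finset ↥(cornerSet Λ)}
    (hS : S ∈ cycles (pieceCornerPerm Λ ξ)) :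
    ∑ c ∈ S, pieceTurn Λ ξ c = 4 ∨ ∑ c ∈ S, pieceTurn Λ ξ c = -4 := by
  obtain ⟨c₀, -, rfl⟩ := mem_image.1 hS
  exact sum_pieceTurn_cls ξ c₀

/-! ### The BKW identity on the piece -/

/-- **The Baxter–Kelland–Wu identity for the free random-cluster loops of a finite piece of
`ℤ²`.** For `0 < q ≤ 4` and every corner functional `κ` on the corners over `Λ` (e.g. the
pairing of the winding number of the loop through `c` with a test function),
`∑_{ξ ⊆ E_Λ} √q^{ℓ_Λ(ξ)} ∏_{S loop of ξ} cos_μ(τ_S ∑_{c∈S} κ c)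
  = ∑_{s : corners → Bool} W_Λ(s) · exp(i ∑_c ε(s c) κ c)`,
with `τ_S = ±1` the sense of rotation of the loop `S` and `W_Λ = BKW.bkwWeight` the six-vertex
weight (`bkwWeight_free_piece_eq_prod` below). By `rcWeight_rcSelfDualPoint` the summand
`√q^{ℓ_Λ(ξ)}` is the free random-cluster weight of `ξ` at `p_sd(q)` up to a constant.
[cite: DuminilCopinKozlowskiLammersManolescu2026, §3.2 (3.2)] -/
theorem bkw_free_piece {q : ℝ} (hq0 : 0 < q) (hq : q ≤ 4) (κ : ↥(cornerSet Λ) → ℝ) :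
    ((∑ ξ ∈ (finsetGraph (zdGraph 2) Λ).edgeFinset.powerset, Real.sqrt q ^ loopCount Λ ξ *
        ∏ S ∈ cycles (pieceCornerPerm Λ ξ),
          cosMu q (cycleSign (pieceTurn Λ ξ) S * ∑ c ∈ S, κ c) : ℝ) : ℂ) =
      ∑ s : ↥(cornerSet Λ) → Bool,
        bkwWeight (finsetGraph (zdGraph 2) Λ).edgeFinset.powerset (pieceCornerPerm Λ) (pieceTurn Λ) q s *
          Complex.exp (I * ∑ c, (sgn (s c) : ℂ) * κ c) :=
  bkw_configuration_sum hq0 hq _ (pieceCornerPerm Λ) (pieceTurn Λ)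
    (fun ξ _ _ hS ↦ sum_pieceTurn_of_mem_cycles ξ hS) κ

/-! ### The six-vertex weight of the piece as a product of local weights -/

variable (Λ) in
/-- The edges of the piece, as edges of `ℤ²`. [cite: Grimmett2006, §4.2 (E_Λ)] -/
def pieceEdges : Finset (Sym2 (Site 2)) :=
  (finsetGraph (zdGraph 2) Λ).edgeFinset.image (Sym2.map Subtype.val)

/-- Membership in `pieceEdges`. [folklore] -/
theorem mem_pieceEdges_iff {e : Sym2 (Site 2)} :
    e ∈ pieceEdges Λ ↔ ∃ e' ∈ (finsetGraph (zdGraph 2) Λ).edgeFinset, Sym2.map Subtype.val e' = e := by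
  simp [pieceEdges]

/-- The edge of the piece below a lifted edge. [folklore] -/
theorem map_mem_pieceEdges_iff {e : Sym2 ↥Λ} :
    Sym2.map Subtype.val e ∈ pieceEdges Λ ↔ e ∈ (finsetGraph (zdGraph 2) Λ).edgeFinset := by
  rw [mem_pieceEdges_iff]
  constructor
  · rintro ⟨e', he', h⟩
    rwa [← Sym2.map.injective Subtype.val_injective h]
  · exact fun h ↦ ⟨e, h, rfl⟩

/-- Endpoints of piece edges lie in `Λ`. [folklore] -/
theorem mem_of_mem_pieceEdges {e : Sym2 (Site 2)} (he : e ∈ pieceEdges Λ) {v : Site 2} (hv : v ∈ e) :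
    v ∈ Λ := by
  obtain ⟨e', -, rfl⟩ := mem_pieceEdges_iff.1 he
  obtain ⟨a, -, rfl⟩ := Sym2.mem_map.1 hv
  exact a.2

/-- Piece edges are lattice edges. [folklore] -/
theorem adj_of_mem_pieceEdges {x y : Site 2} (he : s(x, y) ∈ pieceEdges Λ) : (zdGraph 2).Adj x y := by
  obtain ⟨e', he', h⟩ := mem_pieceEdges_iff.1 he
  have hl : Sym2.map Subtype.val e' ∈ liftCfg Λ {e'} := map_mem_liftCfg_iff.2 (mem_singleton_self _)
  have := liftCfg_subset_edgeSet (ξ := {e'}) (by simpa using he') hl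
  rw [h] at this
  exact this

/-- **The target edge of a corner over `Λ` is a piece edge iff the other endpoint is in `Λ`.**
[folklore] -/
theorem cTgt_mem_pieceEdges_iff (c : ↥(cornerSet Λ)) :
    cTgt (c : Site 2 × Fin 4) ∈ pieceEdges Λ ↔ (c : Site 2 × Fin 4).1 + cornerUnit ((c : Site 2 × Fin 4).2 + 1) ∈ Λ := by
  constructor
  · intro h
    exact mem_of_mem_pieceEdges h (Sym2.mem_mk_right _ _)
  · intro h
    have hx : (c : Site 2 × Fin 4).1 ∈ Λ := mem_cornerSet.1 c.2
    refine mem_pieceEdges_iff.2 ⟨s(⟨_, hx⟩, ⟨_, h⟩), ?_, by rw [Sym2.map_mk]; rfl⟩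
    rw [SimpleGraph.mem_edgeFinset, SimpleGraph.mem_edgeSet]
    exact (SimpleGraph.mem_edgeSet (G := zdGraph 2)).1 (cTgt_mem_edgeSet _)

variable (Λ) in
/-- The configuration of the piece below a configuration `ζ` of lattice edges: the piece edges
whose lift lies in `ζ`. [folklore] -/
def preimCfg (ζ : Finset (Sym2 (Site 2))) : Finset (Sym2 ↥Λ) :=
  (finsetGraph (zdGraph 2) Λ).edgeFinset.filter fun e ↦ Sym2.map Subtype.val e ∈ ζ

/-- `preimCfg` inverts the lift of configurations of the piece. [folklore] -/
theorem preimCfg_image {ξ : Finset (Sym2 ↥Λ)} (hξ : ξ ⊆ (finsetGraph (zdGraph 2) Λ).edgeFinset) :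
    preimCfg Λ (ξ.image (Sym2.map Subtype.val)) = ξ := by
  ext e
  rw [preimCfg, mem_filter, mem_image]
  constructor
  · rintro ⟨-, e', he', h⟩
    rwa [← Sym2.map.injective Subtype.val_injective h]
  · exact fun h ↦ ⟨hξ h, e, h, rfl⟩

/-- For `ζ ⊆ E_Λ` (as lattice edges), the lift of `preimCfg Λ ζ` is `ζ`. [folklore] -/
theorem liftCfg_preimCfg {ζ : Finset (Sym2 (Site 2))} (hζ : ζ ⊆ pieceEdges Λ) :
    liftCfg Λ (preimCfg Λ ζ) = ↑ζ := by
  ext e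
  rw [mem_liftCfg_iff, mem_coe]
  constructor
  · rintro ⟨e', he', rfl⟩
    exact (mem_filter.1 he').2
  · intro he
    obtain ⟨e', he', rfl⟩ := mem_pieceEdges_iff.1 (hζ he)
    exact ⟨e', mem_filter.2 ⟨he', he⟩, rfl⟩

variable (Λ) in
/-- The successor of a corner over `Λ` across its CLOSED target edge: the next corner
counterclockwise around the same vertex. [cite: Smirnov2001, §2] -/
def follow₀ (c : ↥(cornerSet Λ)) : ↥(cornerSet Λ) :=
  ⟨((c : Site 2 × Fin 4).1, (c : Site 2 × Fin 4).2 + 1),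
    mem_cornerSet.2 (show (c : Site 2 × Fin 4).1 ∈ Λ from mem_cornerSet.1 c.2)⟩

variable (Λ) in
/-- The successor of a corner over `Λ` along its OPEN target edge: the corner at the other
endpoint in the same face (junk `c` itself if that endpoint is off `Λ`, which never happens for
an open edge of the piece). [cite: Smirnov2001, §2] -/
def follow₁ (c : ↥(cornerSet Λ)) : ↥(cornerSet Λ) :=
  if h : (c : Site 2 × Fin 4).1 + cornerUnit ((c : Site 2 × Fin 4).2 + 1) ∈ Λ then
    ⟨((c : Site 2 × Fin 4).1 + cornerUnit ((c : Site 2 × Fin 4).2 + 1), (c : Site 2 × Fin 4).2 + 3),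
      mem_cornerSet.2 h⟩
  else c

/-- **Locality of the turning rule of the piece**: for `ζ ⊆ E_Λ`, the successor of a corner is
`follow₁` if its target edge is open and `follow₀` if it is closed. [cite: Smirnov2001, §2] -/
theorem pieceCornerPerm_preimCfg_apply {ζ : Finset (Sym2 (Site 2))} (hζ : ζ ⊆ pieceEdges Λ)
    (c : ↥(cornerSet Λ)) :
    pieceCornerPerm Λ (preimCfg Λ ζ) c =
      if cTgt (c : Site 2 × Fin 4) ∈ ζ then follow₁ Λ c else follow₀ Λ c := by
  classical
  apply Subtype.ext
  rw [pieceCornerPerm_apply_val, liftCfg_preimCfg hζ]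
  by_cases h : cTgt (c : Site 2 × Fin 4) ∈ ζ
  · rw [if_pos h, nextCorner_of_mem (mem_coe.2 h), follow₁,
      dif_pos ((cTgt_mem_pieceEdges_iff c).1 (hζ h))]
  · rw [if_neg h, nextCorner_of_not_mem (fun h' ↦ h (mem_coe.1 h')), follow₀]

/-- Locality of the quarter turns: `-1` along an open target edge, `+1` across a closed one.
[cite: Smirnov2001, §2] -/
theorem pieceTurn_preimCfg_apply {ζ : Finset (Sym2 (Site 2))} (hζ : ζ ⊆ pieceEdges Λ)
    (c : ↥(cornerSet Λ)) :
    pieceTurn Λ (preimCfg Λ ζ) c = if cTgt (c : Site 2 × Fin 4) ∈ ζ then -1 else 1 := by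
  classical
  unfold pieceTurn turnSign
  rw [liftCfg_preimCfg hζ]
  simp only [mem_coe]

/-- Every piece edge is the target of a corner over `Λ`. [folklore] -/
theorem pieceEdges_subset_image_cTgt :
    pieceEdges Λ ⊆ univ.image fun c : ↥(cornerSet Λ) ↦ cTgt (c : Site 2 × Fin 4) := by
  intro e he
  obtain ⟨e', he', rfl⟩ := mem_pieceEdges_iff.1 he
  induction e' using Sym2.ind with
  | h u v =>
    obtain ⟨k, hk⟩ := exists_cornerUnit_of_mem_edgeFinset he'
    refine mem_image.2 ⟨⟨(u.1, k + 3), mem_cornerSet.2 u.2⟩, mem_univ _, ?_⟩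
    rw [Sym2.map_mk, hk, cTgt]
    simp only
    rw [fin4_add_three_add_one]

/-- **The six-vertex weight of the piece, reindexed by lattice configurations**: the weight
computed from `pieceCornerPerm`/`pieceTurn` over `ξ ⊆ E(G_Λ)` equals the weight computed from
the locally-defined turning rule over `ζ ⊆ E_Λ` (lattice edges). [folklore] -/
theorem bkwWeight_free_piece_eq_preim (q : ℝ) (s : ↥(cornerSet Λ) → Bool) :
    bkwWeight (finsetGraph (zdGraph 2) Λ).edgeFinset.powerset (pieceCornerPerm Λ) (pieceTurn Λ) q s =
      bkwWeight (pieceEdges Λ).powerset (fun ζ ↦ pieceCornerPerm Λ (preimCfg Λ ζ))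
        (fun ζ ↦ pieceTurn Λ (preimCfg Λ ζ)) q s := by
  classical
  unfold bkwWeight
  rw [sum_filter, sum_filter, pieceEdges, powerset_image,
    sum_image (image_injOn_powerset_of_injOn (Sym2.map.injective Subtype.val_injective).injOn)]
  refine sum_congr rfl fun ξ hξ ↦ ?_
  beta_reduce
  rw [preimCfg_image (mem_powerset.1 hξ)]

/-- **The six-vertex weight of the piece is a product of local weights** over the target edges
`M` of the corners over `Λ`: boundary edges (never open) contribute their closed local weight,
piece edges the sum of their closed and open local weights. [cite: BaxterKellandWu1976, §4] -/
theorem bkwWeight_free_piece_eq_prod (q : ℝ) (s : ↥(cornerSet Λ) → Bool) :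
    bkwWeight (finsetGraph (zdGraph 2) Λ).edgeFinset.powerset (pieceCornerPerm Λ) (pieceTurn Λ) q s =
      (∏ e ∈ (univ.image fun c : ↥(cornerSet Λ) ↦ cTgt (c : Site 2 × Fin 4)) \ pieceEdges Λ,
          localW (fun c : ↥(cornerSet Λ) ↦ cTgt (c : Site 2 × Fin 4)) (follow₀ Λ) (fun _ ↦ 1) q s e) *
        ∏ e ∈ pieceEdges Λ,
          (localW (fun c : ↥(cornerSet Λ) ↦ cTgt (c : Site 2 × Fin 4)) (follow₀ Λ) (fun _ ↦ 1) q s e +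
            localW (fun c : ↥(cornerSet Λ) ↦ cTgt (c : Site 2 × Fin 4)) (follow₁ Λ) (fun _ ↦ -1) q s e) := by
  classical
  rw [bkwWeight_free_piece_eq_preim]
  have H := bkwWeight_powerset_eq_prod (C := ↥(cornerSet Λ)) (E := Sym2 (Site 2))
    (M := univ.image fun c : ↥(cornerSet Λ) ↦ cTgt (c : Site 2 × Fin 4)) (E₀ := pieceEdges Λ)
    (fun c : ↥(cornerSet Λ) ↦ cTgt (c : Site 2 × Fin 4))
    (fun c ↦ mem_image_of_mem (fun c : ↥(cornerSet Λ) ↦ cTgt (c : Site 2 × Fin 4)) (mem_univ c))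
    pieceEdges_subset_image_cTgt (fun ζ ↦ pieceCornerPerm Λ (preimCfg Λ ζ)) (follow₀ Λ) (follow₁ Λ)
    (fun ζ hζ c ↦ pieceCornerPerm_preimCfg_apply hζ c) (fun ζ ↦ pieceTurn Λ (preimCfg Λ ζ))
    (fun _ ↦ 1) (fun _ ↦ -1) (fun ζ hζ c ↦ pieceTurn_preimCfg_apply hζ c) q s
  exact H

/-! ### The vertex-weight table -/

/-- **The local six-vertex weights of Baxter–Kelland–Wu** in terms of the arrow bits `a, b` of
the two corners arriving at a medial vertex and `u, v` of the corners leaving it around the same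
endpoints: if `a = b` the vertex is of type 5/6 when also `u = v = a` (weight
`c = 2cos(λ/2)`, `c² = 2 + √q`) and violates the ice rule otherwise; if `a ≠ b` it has weight `1`
when exactly one of the two pairings (cross both / follow both) is consistent (types 1–4) and
`0` otherwise. [cite: BaxterKellandWu1976, §4 (weights 1, 1, 1, 1, z^{1/2} + z^{-1/2})] -/
def sixVertexLocalWeight (q : ℝ) (a b u v : Bool) : ℂ :=
  if a = b then (if u = a ∧ v = a then (2 * Real.cos (lam q / 2) : ℂ) else 0)
  else if (u = a ∧ v = b) ∨ (u = b ∧ v = a) then 1 else 0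

/-- The partner of a corner over `Λ` whose target is a piece edge is a corner over `Λ`.
[cite: Smirnov2010, proof of Lemma 4.5] -/
theorem cornerPartner_mem_cornerSet {c : ↥(cornerSet Λ)} (h : cTgt (c : Site 2 × Fin 4) ∈ pieceEdges Λ) :
    cornerPartner (c : Site 2 × Fin 4) ∈ cornerSet Λ :=
  mem_cornerSet.2 ((cTgt_mem_pieceEdges_iff c).1 h)

/-- The corners arriving at the piece edge `cTgt p` are `p` and its partner. [cite: Smirnov2010, proof of Lemma 4.5] -/
theorem filter_cTgt_eq_pair {p : ↥(cornerSet Λ)} (h : cTgt (p : Site 2 × Fin 4) ∈ pieceEdges Λ) :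
    (univ.filter fun c : ↥(cornerSet Λ) ↦ cTgt (c : Site 2 × Fin 4) = cTgt (p : Site 2 × Fin 4)) =
      {p, ⟨cornerPartner (p : Site 2 × Fin 4), cornerPartner_mem_cornerSet h⟩} := by
  ext c
  rw [mem_filter, mem_insert, mem_singleton, cTgt_eq_cTgt_iff]
  simp only [mem_univ, true_and]
  constructor
  · rintro (h1 | h1)
    · exact Or.inl (Subtype.ext h1)
    · exact Or.inr (Subtype.ext h1)
  · rintro (rfl | rfl)
    · exact Or.inl rfl
    · exact Or.inr rfl

/-- The corners arriving at a boundary target edge `cTgt p` (other endpoint off `Λ`): only `p`.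
[folklore] -/
theorem filter_cTgt_eq_singleton {p : ↥(cornerSet Λ)} (h : cTgt (p : Site 2 × Fin 4) ∉ pieceEdges Λ) :
    (univ.filter fun c : ↥(cornerSet Λ) ↦ cTgt (c : Site 2 × Fin 4) = cTgt (p : Site 2 × Fin 4)) = {p} := by
  ext c
  rw [mem_filter, mem_singleton, cTgt_eq_cTgt_iff]
  simp only [mem_univ, true_and]
  constructor
  · rintro (h1 | h1)
    · exact Subtype.ext h1
    · exfalso
      apply h
      rw [cTgt_mem_pieceEdges_iff]
      have hc := mem_cornerSet.1 c.2
      rw [h1, cornerPartner] at hc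
      exact hc
  · rintro rfl
    exact Or.inl rfl

/-- `follow₁` of a corner with piece target exchanges with `follow₀` of the partner: following the
open edge from `p` lands where crossing it from the partner does. [cite: Smirnov2010, proof of Lemma 4.5] -/
theorem follow₁_eq_follow₀_partner {p : ↥(cornerSet Λ)} (h : cTgt (p : Site 2 × Fin 4) ∈ pieceEdges Λ) :
    follow₁ Λ p = follow₀ Λ ⟨cornerPartner (p : Site 2 × Fin 4), cornerPartner_mem_cornerSet h⟩ := by
  apply Subtype.ext
  rw [follow₁, dif_pos ((cTgt_mem_pieceEdges_iff p).1 h), follow₀]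
  simp only [cornerPartner]
  rw [fin4_add_two_add_one]

/-- Symmetrically, `follow₁` of the partner is `follow₀ p`. [cite: Smirnov2010, proof of Lemma 4.5] -/
theorem follow₁_partner_eq_follow₀ {p : ↥(cornerSet Λ)} (h : cTgt (p : Site 2 × Fin 4) ∈ pieceEdges Λ) :
    follow₁ Λ ⟨cornerPartner (p : Site 2 × Fin 4), cornerPartner_mem_cornerSet h⟩ = follow₀ Λ p := by
  have hx : (p : Site 2 × Fin 4).1 ∈ Λ := mem_cornerSet.1 p.2
  apply Subtype.ext
  have hback : (cornerPartner (p : Site 2 × Fin 4)).1 + cornerUnit ((cornerPartner (p : Site 2 × Fin 4)).2 + 1) =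
      (p : Site 2 × Fin 4).1 := by
    simp only [cornerPartner]
    rw [fin4_add_two_add_one, show (p : Site 2 × Fin 4).2 + 3 = (p : Site 2 × Fin 4).2 + 1 + 2 from
      (fin4_add_one_add_two _).symm, cornerUnit_add_two]
    abel
  rw [follow₁, dif_pos (by rw [hback]; exact hx), follow₀]
  simp only [Prod.mk.injEq]
  refine ⟨hback, ?_⟩
  simp only [cornerPartner]
  exact fin4_add_two_add_three _

/-- `e^{ix} e^{ix} + e^{-ix} e^{-ix} = 2cos(2x)`. [folklore] -/
theorem exp_mul_exp_add_exp_neg (x : ℂ) :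
    Complex.exp (I * x) * Complex.exp (I * x) + Complex.exp (-(I * x)) * Complex.exp (-(I * x)) =
      2 * Complex.cos (2 * x) := by
  rw [← Complex.exp_add, ← Complex.exp_add, Complex.two_cos]
  congr 1 <;> congr 1 <;> ring

/-- `e^{-ix} e^{-ix} + e^{ix} e^{ix} = 2cos(2x)`. [folklore] -/
theorem exp_neg_mul_exp_neg_add (x : ℂ) :
    Complex.exp (-(I * x)) * Complex.exp (-(I * x)) + Complex.exp (I * x) * Complex.exp (I * x) =
      2 * Complex.cos (2 * x) := by
  rw [add_comm]; exact exp_mul_exp_add_exp_neg x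

/-- `e^{ix} e^{-ix} = 1`. [folklore] -/
theorem exp_mul_exp_neg (x : ℂ) : Complex.exp (I * x) * Complex.exp (-(I * x)) = 1 := by
  rw [← Complex.exp_add, add_neg_cancel, Complex.exp_zero]

/-- `e^{-ix} e^{ix} = 1`. [folklore] -/
theorem exp_neg_mul_exp (x : ℂ) : Complex.exp (-(I * x)) * Complex.exp (I * x) = 1 := by
  rw [mul_comm]; exact exp_mul_exp_neg x

/-- The vertex-weight table on four booleans. [cite: BaxterKellandWu1976, §4] -/
theorem sixVertex_table (a b u v : Bool) (x : ℂ) :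
    (if u = a then Complex.exp (I * (sgn a : ℂ) * x) else 0) * (if v = b then Complex.exp (I * (sgn b : ℂ) * x) else 0) +
      (if v = a then Complex.exp (I * (sgn a : ℂ) * -x) else 0) * (if u = b then Complex.exp (I * (sgn b : ℂ) * -x) else 0) =
    (if a = b then (if u = a ∧ v = a then 2 * Complex.cos (2 * x) else 0)
      else if (u = a ∧ v = b) ∨ (u = b ∧ v = a) then 1 else 0) := by
  have L1 := exp_mul_exp_add_exp_neg x
  have L2 := exp_neg_mul_exp_neg_add x
  have L3 := exp_mul_exp_neg x
  have L4 := exp_neg_mul_exp x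
  cases a <;> cases b <;> cases u <;> cases v <;> simp [sgn, L1, L2, L3, L4]

/-- **The vertex-weight table.** At a piece edge `e = cTgt p` with arriving corners `p`, `p̂` and
leaving corners `σ⁰p`, `σ⁰p̂`, the sum of the closed and open local weights is
`sixVertexLocalWeight q (s p) (s p̂) (s σ⁰p) (s σ⁰p̂)` — Baxter–Kelland–Wu's `1, 1, 1, 1, c, c`
(`c = e^{iλ/2} + e^{-iλ/2}`: both corners turn left when `e` is closed, both turn right when it
is open) and `0` off the ice rule. [cite: BaxterKellandWu1976, §4] -/
theorem localW_closed_add_localW_open (q : ℝ) (s : ↥(cornerSet Λ) → Bool) {p : ↥(cornerSet Λ)}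
    (h : cTgt (p : Site 2 × Fin 4) ∈ pieceEdges Λ) :
    localW (fun c : ↥(cornerSet Λ) ↦ cTgt (c : Site 2 × Fin 4)) (follow₀ Λ) (fun _ ↦ 1) q s (cTgt (p : Site 2 × Fin 4)) +
      localW (fun c : ↥(cornerSet Λ) ↦ cTgt (c : Site 2 × Fin 4)) (follow₁ Λ) (fun _ ↦ -1) q s (cTgt (p : Site 2 × Fin 4)) =
    sixVertexLocalWeight q (s p) (s ⟨cornerPartner (p : Site 2 × Fin 4), cornerPartner_mem_cornerSet h⟩)
      (s (follow₀ Λ p)) (s (follow₀ Λ ⟨cornerPartner (p : Site 2 × Fin 4), cornerPartner_mem_cornerSet h⟩)) := by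
  classical
  set ph : ↥(cornerSet Λ) := ⟨cornerPartner (p : Site 2 × Fin 4), cornerPartner_mem_cornerSet h⟩ with hph
  have hne : p ≠ ph := fun heq ↦ partner_ne (p : Site 2 × Fin 4) (congrArg Subtype.val heq).symm
  unfold localW
  rw [filter_cTgt_eq_pair h, prod_pair hne, prod_pair hne, follow₁_eq_follow₀_partner h,
    follow₁_partner_eq_follow₀ h, ← hph]
  -- now a statement about four booleans and the phase `x = λ/4`
  simp only [Int.cast_one, Int.cast_neg, mul_one, mul_neg_one]
  have hcos : 2 * Complex.cos (2 * ((lam q : ℂ) / 4)) = (2 * Real.cos (lam q / 2) : ℂ) := by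
    rw [Complex.ofReal_cos]; push_cast; ring_nf
  rw [sixVertex_table (s p) (s ph) (s (follow₀ Λ p)) (s (follow₀ Λ ph)) ((lam q : ℂ) / 4), hcos]
  rfl

/-- **Boundary local weight**: at a target edge with its other endpoint off `Λ` (never open), the
single arriving corner `p` turns left; the weight is the constraint `s (σ⁰ p) = s p` times the
phase `e^{i ε(s p) λ/4}`. [cite: BaxterKellandWu1976, §4] -/
theorem localW_boundary (q : ℝ) (s : ↥(cornerSet Λ) → Bool) {p : ↥(cornerSet Λ)}
    (h : cTgt (p : Site 2 × Fin 4) ∉ pieceEdges Λ) :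
    localW (fun c : ↥(cornerSet Λ) ↦ cTgt (c : Site 2 × Fin 4)) (follow₀ Λ) (fun _ ↦ 1) q s (cTgt (p : Site 2 × Fin 4)) =
      if s (follow₀ Λ p) = s p then Complex.exp (I * (sgn (s p) : ℂ) * (lam q / 4)) else 0 := by
  classical
  unfold localW
  rw [filter_cTgt_eq_singleton h, prod_singleton]
  push_cast
  simp only [mul_one]

end Piece

end Literature.Probability.Percolation

end
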